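import Summits.Ventures.PercRepro.C026C028Pendant

/-!
# C-028(c) through a pendant probe (p6, gen 15; mine-3 MINE3-GLUING §2 (2): "series edges at `c`")

If the probe `c` is pendant — its only edge that is not surely closed is `f`, joining `c` to `x` — then
with `q = p f` the rows at the probe `c` are an affine image of the rows at the probe `x` under the
deletion minor `p[f:=0]`: `x_c = q·x`, `Y_a(c) = q·Y_a(x)`, `Y_b(c) = q·Y_b(x)`, `P(a ↔ b)` unchanged.
Hence the defect and `√(Y_a Y_b)` both scale by `q`, and **C-028(c) at the probe `x` on `p[f:=0]` gives
C-028(c) at the probe `c` on `p`** (`C028At_of_pendantProbe`).  With `C028At_of_pendant` (pendant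
edge at a mark or elsewhere) these are the series / pendant bases of the forest-class decomposition.
-/

namespace PercRepro

namespace MultiGraph

variable {V E : Type*} (G : MultiGraph V E) [Fintype E] [DecidableEq E]

/-- A pendant probe reaches `m ≠ c` iff its edge `f` is open and the other end `x` reaches `m`
(on positive-weight configurations). -/
theorem conn_probe_iff_of_pendant {p : E → ℝ} {f : E} {c x : V}
    (hcx : (G.fst f = c ∧ G.snd f = x) ∨ (G.fst f = x ∧ G.snd f = c))
    (hpend : ∀ e', e' ≠ f → (G.fst e' = c ∨ G.snd e' = c) → p e' = 0)
    {ω : Config E} (hω : 0 < weight p ω) {m : V} (hm : m ≠ c) :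
    G.Conn ω c m ↔ ω f = true ∧ G.Conn ω x m := by
  constructor
  · intro h
    have hf : ω f = true := by
      by_contra hf
      have hf' : ω f = false := by simpa using hf
      have hclosed : ∀ e', (G.fst e' = c ∨ G.snd e' = c) → ω e' = false := by
        intro e' he'
        by_cases h' : e' = f
        · rw [h']; exact hf'
        · exact eq_false_of_weight_pos hω (hpend e' h' he')
      exact hm (G.eq_of_conn_of_closed_at hclosed h)
    exact ⟨hf, (G.conn_transfer hf hcx m).1 h⟩
  · rintro ⟨hf, h⟩
    exact (G.conn_transfer hf hcx m).2 h

/-- The rows at the pendant probe `c` are `q = p f` times the rows at the probe `x` on the deletion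
minor `p[f:=0]` (rows `abc`, `ac|b`, `bc|a`), and `P(a ↔ b)` is unchanged. -/
theorem rows_of_pendantProbe {p : E → ℝ} (hp : IsProb p) {f : E} {c x : V}
    (hcx : (G.fst f = c ∧ G.snd f = x) ∨ (G.fst f = x ∧ G.snd f = c))
    (hpend : ∀ e', e' ≠ f → (G.fst e' = c ∨ G.snd e' = c) → p e' = 0) {a b : V}
    (ha : a ≠ c) (hb : b ≠ c) (hx : x ≠ c) :
    G.law3 p a b c 0 = p f * G.law3 (Function.update p f 0) a b x 0 ∧
      G.law3 p a b c 2 = p f * G.law3 (Function.update p f 0) a b x 2 ∧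
      G.law3 p a b c 3 = p f * G.law3 (Function.update p f 0) a b x 3 ∧
      G.law3 p a b c 0 + G.law3 p a b c 1 =
        G.law3 (Function.update p f 0) a b x 0 + G.law3 (Function.update p f 0) a b x 1 := by
  have hfc : G.fst f = c ∨ G.snd f = c := by
    rcases hcx with ⟨h, _⟩ | ⟨_, h⟩
    · exact Or.inl h
    · exact Or.inr h
  have hrow := G.law3_update_one_eq_update_zero_of_pendant hp hfc hpend ha hb hx
  refine ⟨?_, ?_, ?_, ?_⟩
  · rw [law3_zero, G.partitionEvent_row_abc]
    have h1 : prob p (G.connEvent a b ∩ G.connEvent b c) =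
        prob p ((G.connEvent a b ∩ G.connEvent b x) ∩ {ω | ω f = true}) := by
      refine prob_eq_of_eqOn_pos hp fun ω hω => ?_
      simp only [Set.mem_inter_iff, mem_connEvent, Set.mem_setOf_eq]
      constructor
      · rintro ⟨hab, hbc⟩
        obtain ⟨hf, hxb⟩ := (G.conn_probe_iff_of_pendant hcx hpend hω hb).1 hbc.symm
        exact ⟨⟨hab, hxb.symm⟩, hf⟩
      · rintro ⟨⟨hab, hbx⟩, hf⟩
        exact ⟨hab, ((G.conn_probe_iff_of_pendant hcx hpend hω hb).2 ⟨hf, hbx.symm⟩).symm⟩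
    rw [h1, prob_inter_open, ← G.partitionEvent_row_abc, ← law3_zero, hrow 0]
  · rw [law3_two, G.partitionEvent_row_ac_b]
    have h1 : prob p (G.connEvent a c ∩ G.sepEvent a b) =
        prob p ((G.connEvent a x ∩ G.sepEvent a b) ∩ {ω | ω f = true}) := by
      refine prob_eq_of_eqOn_pos hp fun ω hω => ?_
      simp only [Set.mem_inter_iff, mem_connEvent, mem_sepEvent, Set.mem_setOf_eq]
      constructor
      · rintro ⟨hac, hab⟩
        obtain ⟨hf, hxa⟩ := (G.conn_probe_iff_of_pendant hcx hpend hω ha).1 hac.symm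
        exact ⟨⟨hxa.symm, hab⟩, hf⟩
      · rintro ⟨⟨hax, hab⟩, hf⟩
        exact ⟨((G.conn_probe_iff_of_pendant hcx hpend hω ha).2 ⟨hf, hax.symm⟩).symm, hab⟩
    rw [h1, prob_inter_open, ← G.partitionEvent_row_ac_b, ← law3_two, hrow 2]
  · rw [law3_three, G.partitionEvent_row_bc_a]
    have h1 : prob p (G.connEvent b c ∩ G.sepEvent a b) =
        prob p ((G.connEvent b x ∩ G.sepEvent a b) ∩ {ω | ω f = true}) := by
      refine prob_eq_of_eqOn_pos hp fun ω hω => ?_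
      simp only [Set.mem_inter_iff, mem_connEvent, mem_sepEvent, Set.mem_setOf_eq]
      constructor
      · rintro ⟨hbc, hab⟩
        obtain ⟨hf, hxb⟩ := (G.conn_probe_iff_of_pendant hcx hpend hω hb).1 hbc.symm
        exact ⟨⟨hxb.symm, hab⟩, hf⟩
      · rintro ⟨⟨hbx, hab⟩, hf⟩
        exact ⟨((G.conn_probe_iff_of_pendant hcx hpend hω hb).2 ⟨hf, hbx.symm⟩).symm, hab⟩
    rw [h1, prob_inter_open, ← G.partitionEvent_row_bc_a, ← law3_three, hrow 3]
  · rw [G.law3_zero_add_one, G.law3_zero_add_one, prob_split p f (G.connEvent a b),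
      ← G.law3_zero_add_one, ← G.law3_zero_add_one (Function.update p f 0) a b x, hrow 0, hrow 1]
    ring

/-- **C-028(c) through a pendant probe**: C-028(c) at the probe `x` on the deletion minor `p[f:=0]`
gives C-028(c) at the pendant probe `c` on `p`. -/
theorem C028At_of_pendantProbe {p : E → ℝ} (hp : IsProb p) {f : E} {c x : V}
    (hcx : (G.fst f = c ∧ G.snd f = x) ∨ (G.fst f = x ∧ G.snd f = c))
    (hpend : ∀ e', e' ≠ f → (G.fst e' = c ∨ G.snd e' = c) → p e' = 0) {a b : V}
    (ha : a ≠ c) (hb : b ≠ c) (hx : x ≠ c)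
    (h0 : G.C028At (Function.update p f 0) a b x) : G.C028At p a b c := by
  obtain ⟨r0, r2, r3, rA⟩ := G.rows_of_pendantProbe hp hcx hpend ha hb hx
  have hq : 0 ≤ p f := (hp f).1
  have hd : G.c028Cov p a b c = p f * G.c028Cov (Function.update p f 0) a b x := by
    unfold c028Cov
    rw [rA, r0, r2, r3]
    ring
  unfold C028At at h0 ⊢
  rw [hd, r2, r3]
  have hsq : Real.sqrt (p f * G.law3 (Function.update p f 0) a b x 2 *
      (p f * G.law3 (Function.update p f 0) a b x 3)) =
      p f * Real.sqrt (G.law3 (Function.update p f 0) a b x 2 *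
        G.law3 (Function.update p f 0) a b x 3) := by
    rw [show p f * G.law3 (Function.update p f 0) a b x 2 *
        (p f * G.law3 (Function.update p f 0) a b x 3) =
        (p f) ^ 2 * (G.law3 (Function.update p f 0) a b x 2 *
          G.law3 (Function.update p f 0) a b x 3) by ring,
      Real.sqrt_mul (sq_nonneg _), Real.sqrt_sq hq]
  rw [hsq]
  exact mul_le_mul_of_nonneg_left h0 hq

/-! ### The pendant probe in sure-cluster form -/

omit [DecidableEq E] in
/-- With `f` closed, the cluster of `c` is its sure cluster when every other edge touching the sure
cluster is 0/1. -/
theorem sureConn_of_conn_of_pendantCluster_closed {p : E → ℝ} {f : E} {c : V}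
    (hpend : ∀ e', e' ≠ f → (G.SureConn p c (G.fst e') ∨ G.SureConn p c (G.snd e')) →
      p e' = 0 ∨ p e' = 1)
    {ω : Config E} (hω : 0 < weight p ω) (hf : ω f = false) {v : V} (h : G.Conn ω c v) :
    G.SureConn p c v := by
  refine Conn.induction (motive := fun v => G.SureConn p c v) (Conn.refl G _ c) ?_ h
  intro u w _ hadj hsure
  obtain ⟨e', he', hends⟩ := hadj
  have hne : e' ≠ f := by
    rintro rfl
    rw [hf] at he'
    exact absurd he' (by decide)
  have htouch : G.SureConn p c (G.fst e') ∨ G.SureConn p c (G.snd e') := by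
    rcases hends with ⟨h1, _⟩ | ⟨_, h2⟩
    · exact Or.inl (h1 ▸ hsure)
    · exact Or.inr (h2 ▸ hsure)
  rcases hpend e' hne htouch with h0 | h1
  · exact absurd he' (by rw [eq_false_of_weight_pos hω h0]; decide)
  · have hs : sureConfig p e' = true := by simp [sureConfig, h1]
    exact Conn.trans (show G.Conn (sureConfig p) c u from hsure) (Conn.of_openAdj ⟨e', hs, hends⟩)

omit [DecidableEq E] in
/-- A probe whose sure cluster is touched by the single non-0/1 edge `f = {c', x}` (`c'` in the cluster)
reaches `m` outside the cluster iff `f` is open and `x` reaches `m`. -/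
theorem conn_probe_iff_of_pendantCluster {p : E → ℝ} {f : E} {c c' x : V}
    (hcc' : G.SureConn p c c')
    (hcx : (G.fst f = c' ∧ G.snd f = x) ∨ (G.fst f = x ∧ G.snd f = c'))
    (hpend : ∀ e', e' ≠ f → (G.SureConn p c (G.fst e') ∨ G.SureConn p c (G.snd e')) →
      p e' = 0 ∨ p e' = 1)
    {ω : Config E} (hω : 0 < weight p ω) {m : V} (hm : ¬ G.SureConn p c m) :
    G.Conn ω c m ↔ ω f = true ∧ G.Conn ω x m := by
  have hcc'ω : G.Conn ω c c' := G.conn_of_sureConn_of_weight_pos hω hcc'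
  constructor
  · intro h
    have hf : ω f = true := by
      by_contra hf
      have hf' : ω f = false := by simpa using hf
      exact hm (G.sureConn_of_conn_of_pendantCluster_closed hpend hω hf' h)
    exact ⟨hf, ((G.conn_transfer hf hcx m).1 (hcc'ω.symm.trans h))⟩
  · rintro ⟨hf, h⟩
    exact hcc'ω.trans ((G.conn_transfer hf hcx m).2 h)

/-- **C-028(c) through a pendant probe cluster**: C-028(c) at the probe `x` on `p[f:=0]` gives C-028(c)
at the probe `c` on `p`, when the sure cluster of `c` is touched by the single non-0/1 edge `f` and the
marks `a`, `b` and `x` lie outside it. -/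
theorem C028At_of_pendantProbeCluster {p : E → ℝ} (hp : IsProb p) {f : E} (hf1 : p f ≠ 1)
    {c c' x : V} (hcc' : G.SureConn p c c')
    (hcx : (G.fst f = c' ∧ G.snd f = x) ∨ (G.fst f = x ∧ G.snd f = c'))
    (hpend : ∀ e', e' ≠ f → (G.SureConn p c (G.fst e') ∨ G.SureConn p c (G.snd e')) →
      p e' = 0 ∨ p e' = 1)
    {a b : V} (ha : ¬ G.SureConn p c a) (hb : ¬ G.SureConn p c b) (hx : ¬ G.SureConn p c x)
    (h0 : G.C028At (Function.update p f 0) a b x) : G.C028At p a b c := by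
  have hfc : G.fst f = c' ∨ G.snd f = c' := by
    rcases hcx with ⟨h, _⟩ | ⟨_, h⟩
    · exact Or.inl h
    · exact Or.inr h
  -- rows at the marks `(a, b, x)` do not see `f` (pendant cluster of `c'`, whose sure cluster is `c`'s)
  have hpend' : ∀ e', e' ≠ f → (G.SureConn p c' (G.fst e') ∨ G.SureConn p c' (G.snd e')) →
      p e' = 0 ∨ p e' = 1 := by
    intro e' he' hy
    refine hpend e' he' ?_
    rcases hy with hy | hy
    · exact Or.inl (Conn.trans (show G.Conn (sureConfig p) c c' from hcc') hy)
    · exact Or.inr (Conn.trans (show G.Conn (sureConfig p) c c' from hcc') hy)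
  have hnot : ∀ v, ¬ G.SureConn p c v → ¬ G.SureConn p c' v := fun v hv h =>
    hv (Conn.trans (show G.Conn (sureConfig p) c c' from hcc') h)
  have hrow := G.law3_update_one_eq_update_zero_of_pendantCluster hp hf1 hfc hpend'
    (hnot a ha) (hnot b hb) (hnot x hx)
  -- the three rows at the probe `c`
  have r0 : G.law3 p a b c 0 = p f * G.law3 (Function.update p f 0) a b x 0 := by
    rw [law3_zero, G.partitionEvent_row_abc]
    have h1 : prob p (G.connEvent a b ∩ G.connEvent b c) =
        prob p ((G.connEvent a b ∩ G.connEvent b x) ∩ {ω | ω f = true}) := by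
      refine prob_eq_of_eqOn_pos hp fun ω hω => ?_
      simp only [Set.mem_inter_iff, mem_connEvent, Set.mem_setOf_eq]
      constructor
      · rintro ⟨hab, hbc⟩
        obtain ⟨hf, hxb⟩ :=
          (G.conn_probe_iff_of_pendantCluster hcc' hcx hpend hω hb).1 hbc.symm
        exact ⟨⟨hab, hxb.symm⟩, hf⟩
      · rintro ⟨⟨hab, hbx⟩, hf⟩
        exact ⟨hab,
          ((G.conn_probe_iff_of_pendantCluster hcc' hcx hpend hω hb).2 ⟨hf, hbx.symm⟩).symm⟩
    rw [h1, prob_inter_open, ← G.partitionEvent_row_abc, ← law3_zero, hrow 0]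
  have r2 : G.law3 p a b c 2 = p f * G.law3 (Function.update p f 0) a b x 2 := by
    rw [law3_two, G.partitionEvent_row_ac_b]
    have h1 : prob p (G.connEvent a c ∩ G.sepEvent a b) =
        prob p ((G.connEvent a x ∩ G.sepEvent a b) ∩ {ω | ω f = true}) := by
      refine prob_eq_of_eqOn_pos hp fun ω hω => ?_
      simp only [Set.mem_inter_iff, mem_connEvent, mem_sepEvent, Set.mem_setOf_eq]
      constructor
      · rintro ⟨hac, hab⟩
        obtain ⟨hf, hxa⟩ :=
          (G.conn_probe_iff_of_pendantCluster hcc' hcx hpend hω ha).1 hac.symm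
        exact ⟨⟨hxa.symm, hab⟩, hf⟩
      · rintro ⟨⟨hax, hab⟩, hf⟩
        exact ⟨((G.conn_probe_iff_of_pendantCluster hcc' hcx hpend hω ha).2
          ⟨hf, hax.symm⟩).symm, hab⟩
    rw [h1, prob_inter_open, ← G.partitionEvent_row_ac_b, ← law3_two, hrow 2]
  have r3 : G.law3 p a b c 3 = p f * G.law3 (Function.update p f 0) a b x 3 := by
    rw [law3_three, G.partitionEvent_row_bc_a]
    have h1 : prob p (G.connEvent b c ∩ G.sepEvent a b) =
        prob p ((G.connEvent b x ∩ G.sepEvent a b) ∩ {ω | ω f = true}) := by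
      refine prob_eq_of_eqOn_pos hp fun ω hω => ?_
      simp only [Set.mem_inter_iff, mem_connEvent, mem_sepEvent, Set.mem_setOf_eq]
      constructor
      · rintro ⟨hbc, hab⟩
        obtain ⟨hf, hxb⟩ :=
          (G.conn_probe_iff_of_pendantCluster hcc' hcx hpend hω hb).1 hbc.symm
        exact ⟨⟨hxb.symm, hab⟩, hf⟩
      · rintro ⟨⟨hbx, hab⟩, hf⟩
        exact ⟨((G.conn_probe_iff_of_pendantCluster hcc' hcx hpend hω hb).2
          ⟨hf, hbx.symm⟩).symm, hab⟩
    rw [h1, prob_inter_open, ← G.partitionEvent_row_bc_a, ← law3_three, hrow 3]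
  have rA : G.law3 p a b c 0 + G.law3 p a b c 1 =
      G.law3 (Function.update p f 0) a b x 0 + G.law3 (Function.update p f 0) a b x 1 := by
    rw [G.law3_zero_add_one, G.law3_zero_add_one, prob_split p f (G.connEvent a b),
      ← G.law3_zero_add_one, ← G.law3_zero_add_one (Function.update p f 0) a b x, hrow 0, hrow 1]
    ring
  have hq : 0 ≤ p f := (hp f).1
  have hd : G.c028Cov p a b c = p f * G.c028Cov (Function.update p f 0) a b x := by
    unfold c028Cov
    rw [rA, r0, r2, r3]
    ring
  unfold C028At at h0 ⊢
  rw [hd, r2, r3]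
  have hsq : Real.sqrt (p f * G.law3 (Function.update p f 0) a b x 2 *
      (p f * G.law3 (Function.update p f 0) a b x 3)) =
      p f * Real.sqrt (G.law3 (Function.update p f 0) a b x 2 *
        G.law3 (Function.update p f 0) a b x 3) := by
    rw [show p f * G.law3 (Function.update p f 0) a b x 2 *
        (p f * G.law3 (Function.update p f 0) a b x 3) =
        (p f) ^ 2 * (G.law3 (Function.update p f 0) a b x 2 *
          G.law3 (Function.update p f 0) a b x 3) by ring,
      Real.sqrt_mul (sq_nonneg _), Real.sqrt_sq hq]
  rw [hsq]
  exact mul_le_mul_of_nonneg_left h0 hq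

end MultiGraph

end PercRepro
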